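import Summits.RiemannHypothesis.RiemannHypothesis.Theorems.JensenPolynomialsSkeletonKTable

/-!
# Route `JensenPolynomials` — rung J-P (P1⁺): the table schema and the glue LIFTED TO LAWS `SkeletonSignTestLaw ξ p q n₀`

**RH-FREE.** Theory g8's NEXT-RUNG note (HOME `rh-jensen-theory/g8/NEXT-RUNG.md`, 2026-08-26T13:09Z) places the next kernel rung of
the skeleton sign test at a FAR shift floor: «P1⁺-far» `= SkeletonSignTestLaw ξ 27 200 N_far`, to be closed by ONE far majorant
`Σ_m E_m K_m < 1` over the existing far cone. This file types the two schema statements such a rung consumes, for ARBITRARY constants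
`(p, q, n₀)`:

* `skeletonSignTestLaw_xi_of_tables` — if every cell `(d, n)` of the region `d ≥ 3, n ≥ n₀, p·d³ ≤ q·n` admits a quotient sequence `f`
  (`r_n = f ⋆ s_n` up to `d`) and tables `E`, `K` as in `skeletonSignTest_xi_of_tables` with `Σ_{m=3}^{d} E_m K_m < 1`, then
  `SkeletonSignTestLaw xiTaylorCoeff p q n₀`;
* `cubicThresholdLaw_of_skeletonSignTestLaw` — `SkeletonSignTestLaw ξ p q n₀ → CubicThresholdLaw ξ p q n₀` (G1 cell by cell): any
  certificate law is a hyperbolicity law with the same constants (`theoremAlpha_of_theoremAlphaCert` is the instance `(27, 200, 10⁴)`).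

WHAT THIS IS NOT: no law is proved; no table is supplied; nothing here bears on the truth of RH.
-/

noncomputable section
-- D-0017: `Summit.RiemannHypothesis.RiemannHypothesis.…` duplicates the namespace BY DESIGN (single-problem summit).
set_option linter.dupNamespace false

namespace Summit.RiemannHypothesis.RiemannHypothesis.Theorems.JensenPolynomials

open Literature.NumberTheory.LFunctions Polynomial Finset
open scoped BigOperators Nat

/-- **Certificate law ⇒ hyperbolicity law, same constants** (RH-FREE): for every `(p, q, n₀)`,
`SkeletonSignTestLaw ξ p q n₀ → CubicThresholdLaw ξ p q n₀`. -/
theorem cubicThresholdLaw_of_skeletonSignTestLaw (p q n₀ : ℕ) (h : SkeletonSignTestLaw xiTaylorCoeff p q n₀) :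
    CubicThresholdLaw xiTaylorCoeff p q n₀ :=
  fun d n hd hn hdn => skeletonSignTest_xi_splits d n (h d n hd hn hdn)

/-- **The table schema as a LAW** (RH-FREE): tables cell by cell on the region `d ≥ 3, n ≥ n₀, p·d³ ≤ q·n` give
`SkeletonSignTestLaw xiTaylorCoeff p q n₀`. The cell data are: a quotient sequence `f` with `r_n = f ⋆ s_n` up to index `d`, a
coefficient table `E_m ≥ |C(d,m) f_m|` and a ratio table `K_m` (`|A^{d−m}_{s_n}(e)| ≤ K_m |A^d_{s_n}(e)|` at the critical points of the
skeleton; e.g. via `kTable_of_laguerre_bound`) with `Σ_{m=3}^{d} E_m K_m < 1`. -/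
theorem skeletonSignTestLaw_xi_of_tables (p q n₀ : ℕ)
    (h : ∀ d n : ℕ, 3 ≤ d → n₀ ≤ n → p * d ^ 3 ≤ q * n →
      ∃ f E K : ℕ → ℝ,
        (∀ j ≤ d, windowSeq xiTaylorCoeff n j =
          ∑ i ∈ range (j + 1), (j.choose i : ℝ) * f (j - i) * skeletonSeq xiTaylorCoeff n i) ∧
        (∀ m ∈ Ico 3 (d + 1), |(d.choose m : ℝ) * f m| ≤ E m) ∧
        (∀ m ∈ Ico 3 (d + 1), ∀ e : ℝ, (derivative (appellPoly (skeletonSeq xiTaylorCoeff n) d)).eval e = 0 →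
          |(appellPoly (skeletonSeq xiTaylorCoeff n) (d - m)).eval e| ≤
            K m * |(appellPoly (skeletonSeq xiTaylorCoeff n) d).eval e|) ∧
        ∑ m ∈ Ico 3 (d + 1), E m * K m < 1) :
    SkeletonSignTestLaw xiTaylorCoeff p q n₀ := by
  intro d n hd hn hdn
  obtain ⟨f, E, K, hf, hE, hK, hsum⟩ := h d n hd hn hdn
  exact skeletonSignTest_xi_of_tables d n (by omega) f hf E K hE hK hsum

/-- **Both together**: cell-by-cell tables on the region give the HYPERBOLICITY law `CubicThresholdLaw ξ p q n₀` (RH-FREE). -/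
theorem cubicThresholdLaw_xi_of_tables (p q n₀ : ℕ)
    (h : ∀ d n : ℕ, 3 ≤ d → n₀ ≤ n → p * d ^ 3 ≤ q * n →
      ∃ f E K : ℕ → ℝ,
        (∀ j ≤ d, windowSeq xiTaylorCoeff n j =
          ∑ i ∈ range (j + 1), (j.choose i : ℝ) * f (j - i) * skeletonSeq xiTaylorCoeff n i) ∧
        (∀ m ∈ Ico 3 (d + 1), |(d.choose m : ℝ) * f m| ≤ E m) ∧
        (∀ m ∈ Ico 3 (d + 1), ∀ e : ℝ, (derivative (appellPoly (skeletonSeq xiTaylorCoeff n) d)).eval e = 0 →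
          |(appellPoly (skeletonSeq xiTaylorCoeff n) (d - m)).eval e| ≤
            K m * |(appellPoly (skeletonSeq xiTaylorCoeff n) d).eval e|) ∧
        ∑ m ∈ Ico 3 (d + 1), E m * K m < 1) :
    CubicThresholdLaw xiTaylorCoeff p q n₀ :=
  cubicThresholdLaw_of_skeletonSignTestLaw p q n₀ (skeletonSignTestLaw_xi_of_tables p q n₀ h)

end Summit.RiemannHypothesis.RiemannHypothesis.Theorems.JensenPolynomials

end
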